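/-
Copyright (c) 2026 the pub-hodgecm-mathlib formalisation cell (harness21).  Prover seat hodgecm-mathlib-K2Liu-p05 (g4), 2026-09-04
(Track B «K2-LIT», crux hLiu418 = stmt-HodgeConjecture-24832, LEAD F0P6-plan (g13) RULING M-157m (1) organ (SD-1-ind), (V-2∕3) DEFS leaf:
the weighted translated cone integrals of Shimura's `η` along a `g`-line and an `h`-line, and the polynomials driving their `t`-derivatives).
-/
import Summits.HodgeConjecture.HodgeConjecture.Theorems.K2LiuHermTwoEtaDefs       -- ★ DEFS leaf (K2E5-p16): `hermTwo`, `etaTwoSet`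
import Mathlib.Algebra.MvPolynomial.PDeriv
import HarnessLib

/-!
# (SD-1-ind, V-2∕3) DEFS leaf: weighted translated cone integrals of `η` along lines in `g` and `h`

Track B ∕ K2-LIT, hLiu418 = stmt-HodgeConjecture-24832; LEAD F0P6-plan (g13) RULING M-157m (1).  Namespace
`Summit.HodgeConjecture.HodgeConjecture.Cruxes.HLiu418.K2LiuEtaConeDerivDefs`.  DEFINITIONS WITH BODIES + `rfl`∕algebraic API (no instance, no notation,
no named fact, no `sorry`); Mathlib + ★ DEFS leaf `hermTwo`; `--supports stmt-HodgeConjecture-24832 --as helper` (definitions ⇒ review lane).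

THE OBJECTS (charts `u, d, ξ, e, θ : ℝ × ℂ × ℝ` of `x' − πh = û`, `2g = hermTwo d`, direction `Ξ = hermTwo ξ`, `πh = hermTwo e`, direction `Θ = hermTwo θ`).
After the translation `x' = u + πh` (K2E5-p16 (g5)'s ★ `etaTwo_eq_integral_comp_add`), Shimura's `η(2g, πh; α, β)` is the `W = 1`, `γ = α − 2`, `t = 0` case of
  `coneIntegral W γ β d ξ e θ t = ∫_{u > 0} W(û_{jk}, t) · e^{−tr((û + ĥ_t) ĝ_t)} · det(û + 2ĥ_t)^{γ} · det(û)^{β − 2} du`,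
`ĝ_t = hermTwo (d + t•ξ)`, `ĥ_t = hermTwo (e + t•θ)`, with a polynomial weight `W ∈ ℂ[X_{jk}, T]` in the entries of `û` and the parameter `t`
(`coneVal u t` = the valuation).  The exponent and the moving determinant are themselves polynomials (`expPoly`, `detPoly`), so
`∂_t` acts on the data by `(W, γ) ↦ (∂_T W + W·∂_T expPoly, γ) + (γ·W·∂_T detPoly, γ − 1)` — `derivWeight₀`, `derivWeight₁` — and the `t`-derivatives
of `coneIntegral` stay in the class (THEOREMS in ★-to-be `K2LiuEtaConeIntegralLineDerivatives`).  `θ = 0`: `g`-line derivatives = `u`-moments (the (SD-2)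
currency of `xiShift (g₀ + t•Ξ)`); `ξ = 0`: `h`-line derivatives, lowering `γ`.

HONEST LABEL: HC_CM is proved only modulo the 7 printed citations (2 remaining named inputs: hLiu418 = stmt-HodgeConjecture-24832, h413 =
stmt-HodgeConjecture-24833) until rung 0 closes; count-neutral DEFS leaf.

## References
G. Shimura, *Confluent hypergeometric functions on tube domains*, Math. Ann. 260 (1982), §3 (orientation; bib key [Shimura1997] §16).
-/

set_option autoImplicit false
set_option linter.dupNamespace false

noncomputable section

open scoped Matrix ComplexConjugate ComplexOrder
open Complex Matrix MeasureTheory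
open Summit.HodgeConjecture.HodgeConjecture.Cruxes.HLiu418.K2LiuHermTwoGammaDefs
open Summit.HodgeConjecture.HodgeConjecture.Cruxes.HLiu418.K2LiuHermTwoEtaDefs

namespace Summit.HodgeConjecture.HodgeConjecture.Cruxes.HLiu418.K2LiuEtaConeDerivDefs

/-! ## The valuation and the three polynomials -/

/-- THE VALUATION at a cone point `u` and parameter `t`: `X_{jk} ↦ (hermTwo u)_{jk}`, `T ↦ t`. -/
def coneVal (u : ℝ × ℂ × ℝ) (t : ℝ) : (Fin 2 × Fin 2) ⊕ Unit → ℂ :=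
  Sum.elim (fun jk => hermTwo u jk.1 jk.2) (fun _ => (t : ℂ))

/-- THE TRACE FORM of a direction as a polynomial: `tracePoly ξ = Σ_{jk} (hermTwo ξ)_{kj} X_{jk}` (value `tr(û · hermTwo ξ)`). -/
def tracePoly (ξ : ℝ × ℂ × ℝ) : MvPolynomial ((Fin 2 × Fin 2) ⊕ Unit) ℂ :=
  ∑ jk : Fin 2 × Fin 2, MvPolynomial.C (hermTwo ξ jk.2 jk.1) * MvPolynomial.X (Sum.inl jk)

/-- THE EXPONENT POLYNOMIAL: `expPoly d ξ e θ = −tr((û + hermTwo e + T·hermTwo θ) · (hermTwo d + T·hermTwo ξ))` as a polynomial in `(X, T)`. -/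
def expPoly (d ξ e θ : ℝ × ℂ × ℝ) : MvPolynomial ((Fin 2 × Fin 2) ⊕ Unit) ℂ :=
  -((tracePoly d + MvPolynomial.X (Sum.inr ()) * tracePoly ξ) +
    (MvPolynomial.C ((hermTwo e * hermTwo d).trace) + MvPolynomial.X (Sum.inr ()) * MvPolynomial.C ((hermTwo θ * hermTwo d).trace + (hermTwo e * hermTwo ξ).trace) +
      MvPolynomial.X (Sum.inr ()) ^ 2 * MvPolynomial.C ((hermTwo θ * hermTwo ξ).trace)))

/-- THE MOVING DETERMINANT: `detPoly e θ = det(û + 2·hermTwo e + 2T·hermTwo θ)` as a polynomial in `(X, T)`. -/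
def detPoly (e θ : ℝ × ℂ × ℝ) : MvPolynomial ((Fin 2 × Fin 2) ⊕ Unit) ℂ :=
  (MvPolynomial.X (Sum.inl (0, 0)) + MvPolynomial.C (2 * (e.1 : ℂ)) + MvPolynomial.C (2 * (θ.1 : ℂ)) * MvPolynomial.X (Sum.inr ())) *
      (MvPolynomial.X (Sum.inl (1, 1)) + MvPolynomial.C (2 * (e.2.2 : ℂ)) + MvPolynomial.C (2 * (θ.2.2 : ℂ)) * MvPolynomial.X (Sum.inr ())) -
    (MvPolynomial.X (Sum.inl (0, 1)) + MvPolynomial.C (2 * e.2.1) + MvPolynomial.C (2 * θ.2.1) * MvPolynomial.X (Sum.inr ())) *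
      (MvPolynomial.X (Sum.inl (1, 0)) + MvPolynomial.C (2 * conj e.2.1) + MvPolynomial.C (2 * conj θ.2.1) * MvPolynomial.X (Sum.inr ()))

/-! ## The kernel, the integral, the derived weights -/

/-- THE WEIGHTED TRANSLATED CONE KERNEL: `W(û, t) · e^{−tr((û + ĥ_t) ĝ_t)} · det(û + 2ĥ_t)^{γ} · det(û)^{β − 2}`,
`ĝ_t = hermTwo (d + t•ξ)`, `ĥ_t = hermTwo (e + t•θ)`. -/
def coneKernel (W : MvPolynomial ((Fin 2 × Fin 2) ⊕ Unit) ℂ) (γ β : ℂ) (d ξ e θ : ℝ × ℂ × ℝ) (t : ℝ) (u : ℝ × ℂ × ℝ) : ℂ :=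
  MvPolynomial.eval (coneVal u t) W *
    (cexp (-(hermTwo (u + (e + t • θ)) * hermTwo (d + t • ξ)).trace) *
      ((hermTwo (u + (2 : ℝ) • (e + t • θ))).det ^ γ * (hermTwo u).det ^ (β - 2)))

/-- THE WEIGHTED TRANSLATED CONE INTEGRAL `∫_{u > 0} coneKernel`. -/
def coneIntegral (W : MvPolynomial ((Fin 2 × Fin 2) ⊕ Unit) ℂ) (γ β : ℂ) (d ξ e θ : ℝ × ℂ × ℝ) (t : ℝ) : ℂ :=
  ∫ u in {c : ℝ × ℂ × ℝ | (hermTwo c).PosDef}, coneKernel W γ β d ξ e θ t u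

/-- THE DERIVED WEIGHT AT THE SAME EXPONENT: `∂_T W + W · ∂_T expPoly`. -/
def derivWeight₀ (d ξ e θ : ℝ × ℂ × ℝ) (W : MvPolynomial ((Fin 2 × Fin 2) ⊕ Unit) ℂ) : MvPolynomial ((Fin 2 × Fin 2) ⊕ Unit) ℂ :=
  MvPolynomial.pderiv (Sum.inr ()) W + W * MvPolynomial.pderiv (Sum.inr ()) (expPoly d ξ e θ)

/-- THE DERIVED WEIGHT AT THE LOWERED EXPONENT `γ − 1`: `γ · W · ∂_T detPoly`. -/
def derivWeight₁ (e θ : ℝ × ℂ × ℝ) (γ : ℂ) (W : MvPolynomial ((Fin 2 × Fin 2) ⊕ Unit) ℂ) : MvPolynomial ((Fin 2 × Fin 2) ⊕ Unit) ℂ :=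
  MvPolynomial.C γ * W * MvPolynomial.pderiv (Sum.inr ()) (detPoly e θ)

/-! ## Unfolding lemmas -/

/-- Unfolding of `coneVal` on an entry variable. -/
@[simp] theorem coneVal_inl (u : ℝ × ℂ × ℝ) (t : ℝ) (jk : Fin 2 × Fin 2) : coneVal u t (Sum.inl jk) = hermTwo u jk.1 jk.2 := rfl

/-- Unfolding of `coneVal` on the parameter variable. -/
@[simp] theorem coneVal_inr (u : ℝ × ℂ × ℝ) (t : ℝ) (o : Unit) : coneVal u t (Sum.inr o) = (t : ℂ) := rfl

/-- Unfolding of `coneKernel`. -/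
theorem coneKernel_apply (W : MvPolynomial ((Fin 2 × Fin 2) ⊕ Unit) ℂ) (γ β : ℂ) (d ξ e θ : ℝ × ℂ × ℝ) (t : ℝ) (u : ℝ × ℂ × ℝ) :
    coneKernel W γ β d ξ e θ t u = MvPolynomial.eval (coneVal u t) W *
      (cexp (-(hermTwo (u + (e + t • θ)) * hermTwo (d + t • ξ)).trace) *
        ((hermTwo (u + (2 : ℝ) • (e + t • θ))).det ^ γ * (hermTwo u).det ^ (β - 2))) := rfl

/-- Unfolding of `coneIntegral`. -/
theorem coneIntegral_def (W : MvPolynomial ((Fin 2 × Fin 2) ⊕ Unit) ℂ) (γ β : ℂ) (d ξ e θ : ℝ × ℂ × ℝ) (t : ℝ) :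
    coneIntegral W γ β d ξ e θ t = ∫ u in {c : ℝ × ℂ × ℝ | (hermTwo c).PosDef}, coneKernel W γ β d ξ e θ t u := rfl

/-- Unfolding of `derivWeight₀`. -/
theorem derivWeight₀_def (d ξ e θ : ℝ × ℂ × ℝ) (W : MvPolynomial ((Fin 2 × Fin 2) ⊕ Unit) ℂ) :
    derivWeight₀ d ξ e θ W = MvPolynomial.pderiv (Sum.inr ()) W + W * MvPolynomial.pderiv (Sum.inr ()) (expPoly d ξ e θ) := rfl

/-- Unfolding of `derivWeight₁`. -/
theorem derivWeight₁_def (e θ : ℝ × ℂ × ℝ) (γ : ℂ) (W : MvPolynomial ((Fin 2 × Fin 2) ⊕ Unit) ℂ) :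
    derivWeight₁ e θ γ W = MvPolynomial.C γ * W * MvPolynomial.pderiv (Sum.inr ()) (detPoly e θ) := rfl

/-! ## The polynomials evaluate to the trace exponent and the moving determinant -/

/-- `tracePoly ξ` evaluates to `tr(û · hermTwo ξ)`. -/
theorem eval_tracePoly (ξ u : ℝ × ℂ × ℝ) (t : ℝ) : MvPolynomial.eval (coneVal u t) (tracePoly ξ) = (hermTwo u * hermTwo ξ).trace := by
  simp only [tracePoly, Fintype.sum_prod_type, Fin.sum_univ_two, map_mul, map_add, MvPolynomial.eval_C, MvPolynomial.eval_X, coneVal_inl,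
    Matrix.trace_fin_two, Matrix.mul_apply]
  ring

/-- `expPoly` evaluates to the trace exponent `−tr((û + ĥ_t) ĝ_t)`. -/
theorem eval_expPoly (d ξ e θ u : ℝ × ℂ × ℝ) (t : ℝ) :
    MvPolynomial.eval (coneVal u t) (expPoly d ξ e θ) = -(hermTwo (u + (e + t • θ)) * hermTwo (d + t • ξ)).trace := by
  simp only [expPoly, map_neg, map_add, map_mul, map_pow, MvPolynomial.eval_C, MvPolynomial.eval_X, coneVal_inr, eval_tracePoly, hermTwo_add,
    hermTwo_smul, add_mul, mul_add, Matrix.smul_mul, Matrix.mul_smul, trace_add, trace_smul, smul_eq_mul]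
  ring

/-- `detPoly` evaluates to the moving determinant `det(û + 2ĥ_t)`. -/
theorem eval_detPoly (e θ u : ℝ × ℂ × ℝ) (t : ℝ) :
    MvPolynomial.eval (coneVal u t) (detPoly e θ) = (hermTwo (u + (2 : ℝ) • (e + t • θ))).det := by
  rw [Matrix.det_fin_two]
  simp only [detPoly, map_sub, map_mul, map_add, MvPolynomial.eval_C, MvPolynomial.eval_X, coneVal_inl, coneVal_inr,
    hermTwo_apply_zero_zero, hermTwo_apply_zero_one, hermTwo_apply_one_zero, hermTwo_apply_one_one, Prod.fst_add, Prod.snd_add,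
    Prod.smul_fst, Prod.smul_snd, smul_eq_mul, Complex.real_smul, map_add, map_mul, Complex.conj_ofReal]
  push_cast
  ring

end Summit.HodgeConjecture.HodgeConjecture.Cruxes.HLiu418.K2LiuEtaConeDerivDefs

end
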